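import Summits.QuantumFields.YangMills.Theorems.BalabanUVNodesRateCarriersOfRecord11
import Literature.MathematicalPhysics.QuantumFieldTheory.Balaban1983to89.Node00.Record12DatumKey

/-!
# THE RATE-CARRIER PREDICATE OF RECORD AT NODE 00's REPAIRED STAGE 12 — layer B of the RATE-RECORD HOME at `Record12`: `YMDAG.UVSplit.RRec₁₂ 𝔯 : RateRecordPred N`,
# KEYED BY THE DATUM (`Node00.IsDatumOfRecord₁₂C F N D`, canonical parameter `h.params` with its provisos `h.provisos`) to the rate objects of layer A read at
# def-T's `Stage12Params` (12b v2∕v2.1, p458710 ∕ p459432): the bundle of run length `k` at `(F, D, g₀, os)` IS `rateCarriersOfRecord₁₂ 𝔯 F h.params h.provisos g₀ os k`;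
# the ONE-APPLICATION faces of the K4 stubs `S_N14 … S_N22`, `S_D4`, `S_R00x`, K4's hooks `RateInputs ∕ RateInputsAll`; and THE LOCATED VACUITY OF THE STAGE-11 HOME
# as a kernel fact (`k4_rRec₁₁_outright`)

Track A of `YM-PLAN.md` (cell `pub-ymgap`, HUMAN RULING D-0062).  The (T-RATE) pen's own re-key `11 ↦ 12` of layer B `…RateCarriersOfRecord11.lean` (p457330), per
dag-lead's DEDUP-165 ruling (pub-ymgap INBOX l.13029, 2026-08-26: «the UNOWNED piece is LAYER B at ₁₂ = the re-key of n22-e's p457330 (`RRec₁₂`∕`rateCarriersOfRecord₁₂`,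
importing RR-2's key once landed)») and director-ym LINE №81 (3) ∕ №93 («every ₁₁ module re-instantiates at `Record12`»).  WHY A RE-KEY IS NEEDED: node00-def-T LOCATED-2
(`Node00.not_isRecordOfRecord₁₁C`, `Record12.lean`): Stage 11 AS PINNED has NO record (`Provisos₁₁.alphaPos` over all runs reads `0 < 0` at the run `⟨0,0,0⟩`), so every
Stage-11 datum key is EMPTY and the six K4 stubs at `RRec₁₁ 𝔯` hold WITH NO ESTIMATE — proved below as `k4_rRec₁₁_outright` (R457 (A) vacuity-certificate rail); the K4
content of the NE-side starts at the repaired Stage 12.  Definition lane (one `structure`, four `def`s); every theorem is kernel bookkeeping over tree declarations BY NAME;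
0 `sorry`, standard axioms.  COUNT-NEUTRAL; `--supports` the K3 item (stmt-QuantumFields-19676; K3′ `SpineGivenEndpointR12` at rev 8).  Restate-immune (no Theses import).

IMPORTS.  Layer B at ₁₁ (p457330: its STAGE-FREE `towerData₁₁ ∕ prependCoupling_eq_prepend ∕ ne3OfRecord₁₁ ∕ ne2OfRecord₁₁` and `RRec₁₁` are REUSED, never redeclared; it
brings layer A's stage-free containers `U3Letters₁₁ ∕ U3Objects₁₁ ∕ U3Tower₁₁ ∕ NE3Objects₁₁ ∕ NE2Objects₁₁ ∕ RateObjects₁₁` and the Stage-11 key) and RR-2 g2's Stage-12 key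
`Node00/Record12DatumKey` (`IsDatumOfRecord₁₂C`, `.params ∕ .provisos ∕ .admissible ∕ .eq_datumOfRecord₁₂ ∕ .gamma_pos ∕ .exists_world_gamma`, `RateAssignment₁₂`; brings `Record12`).

THE DEFINITION («PINS ONLY», keyed through the DATUM KEY as at ₁₁).  A RATE READING `𝔯 : RateReading₁₂ N` is the pair of RESIDUAL assignments the objects of record are read
from, AT A STAGE-12 TUPLE WITH ITS PROVISOS (readings TAKE the provisos — RR-1 g2 PRE-INTENT-3 ∕ RR-2 g0 NOTE 4: objects of record such as `towerOfRecord₁₂ θ h` need `h`;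
RR-2's proviso-free `RateAssignment₁₂` embeds by `RateReading₁₂.ofAssignment`): `𝔯.lit F θ hP g₀ os : RateObjects₁₁ N` (node U3's objects and letter block, the single-scale
layers `ne3 k`, `ne2 k`) and `𝔯.ne1 F θ hP g₀ os` (N14's dressed tower, Summits-typed).  The bundle of RUN LENGTH `k` is `rateCarriersOfRecord₁₂ 𝔯 F θ hP g₀ os k` with U3
component `u3OfRecord₁₂ θ u k := ⟨u.levelCarriers k, Window θ.γ, θ.γ, u.κ, u.EA k, u.EB k, u.θ₅, u.C₅, u.moduli, u.C₉, u.ω, u.cr, u.ρ⟩` (`θ.γ` read through `toStage9Params`;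
this IS the Stage-11 bundle of def-T's view `θ.toStage11 F N p` for every run `p` — `u3OfRecord₁₂_eq_toStage11`, `rfl` — so every θ-generic Stage-11 slot closer applies
verbatim), and `RRec₁₂ 𝔯 F D g₀ os R :↔ ∃ (h : Node00.IsDatumOfRecord₁₂C F N D) (k : ℕ), R = rateCarriersOfRecord₁₂ 𝔯 F h.params h.provisos g₀ os k`.

WHAT THIS MODULE PROVES (all bookkeeping).
* §1 node U3's bundle at Stage 12 and its faces: `u3OfRecord₁₂_W ∕ _γ ∕ _Λ ∕ _C ∕ _EA ∕ _EB` (`rfl`), `u3OfRecord₁₂_eq_toStage11` (`rfl`), `fadingMemory_u3OfRecord₁₂`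
  (**`FadingMemory` BY NAME from the letter signs**), `n22At_u3OfRecord₁₂_iff` (under the signs `N22At` IS `NE9` alone), `u3OfRecord₁₂_objects` (tower-slot literal).
* §2 the reading, the bundle, the predicate and its faces: `RateReading₁₂.ofAssignment(_lit ∕ _ne1)`, `rRec₁₂_iff` (`Iff.rfl`), `rRec₁₂_self`,
  `RRec₁₂.datumKey ∕ .stage12 ∕ .home ∕ .window ∕ .moduli ∕ .gamma_pos ∕ .ne3_L ∕ .two_le_ne3_L ∕ .other_level`, `rRec₁₂_congr` (re-key tool),
  `exists_rRec₁₂_of_isRecordOfRecord₁₂C`.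
* §3 the one-application instances: `forall_datumKey₁₂_of_forall_admissible` (θ-FORM transfer), `s_N14 ∕ s_N15 ∕ s_N16 ∕ s_N17 ∕ s_N18 ∕ s_N22 ∕ s_D4_rRec₁₂_iff`,
  `rateInputs_rRec₁₂_iff`, `rateInputsAll_rRec₁₂_iff` (K4's two hooks at the home).
* §4 `s_R00x_rRec₁₂` (K4's existence stub PROVED OUTRIGHT at `IsRecordOfRecord₁₂C`: existence is free because the objects are residual), `exists_pinned_rRec₁₂_of_inhabited`
  (K0′ link), `k4_rRec₁₂_of_uninhabited` (honesty, hypothesis form) and **`k4_rRec₁₁_outright`** (THE LOCATED VACUITY OF THE STAGE-11 HOME: for EVERY reading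
  `𝔯 : RateReading₁₁ N` the seven stubs `S_N14 ∧ … ∧ S_N22 ∧ S_D4 (RRec₁₁ 𝔯)` hold with NO estimate — `Node00.not_isRecordOfRecord₁₁C`).

HONEST FRAMING (binding).  PINS ONLY; EVERY rate object is read from the RESIDUAL reading `𝔯` until a definer PINS it by name (node00-def-W1's `𝔯_W1` for node U3's functionals;
N16's letters; N15's paired instances; NODE O's dressed tower → `𝔯.ne1`) — so `S_N14 … S_N22 (RRec₁₂ 𝔯)` are statements ABOUT `𝔯`'s objects: contentful for a constructed `𝔯`,
refutable for a junk `𝔯`; **a skeleton quoting `S_N1x (RRec₁₂ 𝔯)` NAMES its `𝔯`.**  Nothing of Bałaban's is asserted or instantiated; NE1′ ∕ NE2 ∕ NE3 ∕ NE4 ∕ NE5 ∕ NE9 are NOT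
PRINTED for d = 4 and NOT PROVED; no inhabitant of `IsDatumOfRecord₁₂C` is claimed (K0′ `Record12Inhabited` open); no node is discharged (typed 28∕28, discharged count
untouched); one finite four-torus programme at fixed `ε`, Bałaban as printed — NOT ℝ⁴, NOT infinite volume, NOT OS, NOT a mass gap, NOT Clay.  No decl below carries a cite tag.
-/

noncomputable section

namespace YMDAG.UVSplit

open Literature.MathematicalPhysics.QuantumFieldTheory.Balaban1983to89
open Literature.MathematicalPhysics.QuantumFieldTheory.Balaban1983to89.T4Continuum
open Literature.MathematicalPhysics.QuantumFieldTheory.Balaban1983to89.T4OutputRate (Carriers Functional Window NE9 FadingMemory)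
open Summit.QuantumFields.BalabanUV.T4Continuum.NE9.TowerCarriers (TowerData prepend)
open Node00 (Stage11Params Stage12Params datumOfRecord₁₂ IsRecordOfRecord₁₁C IsRecordOfRecord₁₂C IsDatumOfRecord₁₁C IsDatumOfRecord₁₂C U3Letters₁₁ U3Objects₁₁
  U3Tower₁₁ NE3Objects₁₁ NE2Objects₁₁ RateObjects₁₁ RateAssignment₁₂ prependCoupling ne3LOfRecord₁₁)

variable {N : ℕ} [NeZero N]

/-! ## §1 Node U3's bundle of record at run length `k`, Stage 12, and its faces -/

/-- **NODE U3's BUNDLE OF RECORD AT RUN LENGTH `k`** for Stage-12 parameters `θ` and U3 objects `u`: the level-`k` pair carriers, the window `]0, θ.γ]` (radius `θ.γ`,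
read through `toStage9Params`), the level functional `u.EA k`, run B's family `u.EB k`, the K-UNIFORM letter block with moduli `u.moduli k i = C₉·ω^{k−i}`. -/
def u3OfRecord₁₂ {F : T4Family} (θ : Stage12Params F N) (u : U3Objects₁₁) (k : ℕ) : U3Carriers :=
  ⟨u.levelCarriers k, Window θ.γ, θ.γ, u.κ, u.EA k, u.EB k, u.θ₅, u.C₅, u.moduli, u.C₉, u.ω, u.cr, u.ρ⟩

section BundleFaces

variable {F : T4Family} (θ : Stage12Params F N) (u : U3Objects₁₁) (k : ℕ)

/-- The window of the bundle is `]0, θ.γ]` (`rfl`). -/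
theorem u3OfRecord₁₂_W : (u3OfRecord₁₂ θ u k).W = Window (u3OfRecord₁₂ θ u k).γ := rfl
/-- Its radius is `θ.γ` (`rfl`). -/
theorem u3OfRecord₁₂_γ : (u3OfRecord₁₂ θ u k).γ = θ.γ := rfl
/-- Its carriers are the level-`k` carriers (`rfl`). -/
theorem u3OfRecord₁₂_C : (u3OfRecord₁₂ θ u k).C = u.levelCarriers k := rfl
/-- Its run-A functional is the level functional (`rfl`). -/
theorem u3OfRecord₁₂_EA : (u3OfRecord₁₂ θ u k).EA = u.EA k := rfl
/-- Its run-B family is the level family (`rfl`). -/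
theorem u3OfRecord₁₂_EB : (u3OfRecord₁₂ θ u k).EB = u.EB k := rfl

/-- Its history moduli ARE `C₉·ω^{a−i}` (the analytic-slot shape `R.u3.Λ = fun a i => R.u3.C₉ * R.u3.ω ^ (a - i)`, `rfl`). -/
theorem u3OfRecord₁₂_Λ : (u3OfRecord₁₂ θ u k).Λ = fun a i => (u3OfRecord₁₂ θ u k).C₉ * (u3OfRecord₁₂ θ u k).ω ^ (a - i) := rfl

/-- **THE STAGE-12 BUNDLE IS THE STAGE-11 BUNDLE OF def-T's STAGE-11 VIEW** `θ.toStage11 F N p`, for EVERY run `p` (only `θ.γ` is read; `rfl`) — so every θ-generic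
Stage-11 slot closer over `u3OfRecord₁₁` (`…N18AtRateRecord11Home.n18At_u3OfRecord₁₁_iff`, `…N22AtRateRecord11Slots.n22At_u3OfRecord₁₁_of_osc*`, …) applies verbatim. -/
theorem u3OfRecord₁₂_eq_toStage11 (p : B12.RunParams) : u3OfRecord₁₂ θ u k = u3OfRecord₁₁ (θ.toStage11 F N p) u k := rfl

/-- **`FadingMemory` BY NAME FROM THE LETTER SIGNS**: the bundle's moduli are `C₉·ω^{k−i}` by construction, so under the displayed signs (`0 ≤ C₉`, `0 ≤ ω`) the
fading-memory half of `N22At` holds at EVERY level with NO estimate. -/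
theorem fadingMemory_u3OfRecord₁₂ (hs : u.Signs) :
    FadingMemory (u3OfRecord₁₂ θ u k).C₉ (u3OfRecord₁₂ θ u k).ω (u3OfRecord₁₂ θ u k).Λ :=
  fun a i _ => ⟨hs.moduli_nonneg a i, le_rfl⟩

/-- **UNDER THE SIGNS, `N22At` AT THE BUNDLE IS `NE9` ALONE** — the joint history-Lipschitz bound of the level functional on `]0, θ.γ]` with the moduli of record. -/
theorem n22At_u3OfRecord₁₂_iff (hs : u.Signs) :
    N22At (u3OfRecord₁₂ θ u k) ↔ NE9 (u.EA k) (Window θ.γ) u.κ u.moduli :=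
  ⟨fun h => h.1, fun h => ⟨h, fadingMemory_u3OfRecord₁₂ θ u k hs⟩⟩

/-- **THE BUNDLE OF A TOWER READING IS THE TOWER-SLOT LITERAL** (the shape `YMDAG.N22.s_N22_of_s_N18_towerKeyed` ∕ `YMDAG.N18.HLayer.s_N18_of_comap_congr` destructure;
layer B at ₁₁'s `u3OfRecord₁₁_objects` through the Stage-11 view). -/
theorem u3OfRecord₁₂_objects (t : U3Tower₁₁) (ℓ : U3Letters₁₁) :
    u3OfRecord₁₂ θ (t.objects ℓ) k =
      ⟨(towerData₁₁ t).level k, Window θ.γ, θ.γ, ℓ.κ, t.E k, fun b g U X => t.E (k + 1) (prepend b g) U X, ℓ.θ₅, ℓ.C₅,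
        fun a i => ℓ.C₉ * ℓ.ω ^ (a - i), ℓ.C₉, ℓ.ω, ℓ.cr, ℓ.ρ⟩ :=
  u3OfRecord₁₁_objects (θ.toStage11 F N ⟨0, 0, 0⟩) k t ℓ

end BundleFaces

/-! ## §2 The Stage-12 rate reading, the bundle of record, the predicate `RRec₁₂` and its faces -/

/-- **A STAGE-12 RATE READING**: the two RESIDUAL assignments the rate carriers of record are read from, AT A STAGE-12 TUPLE WITH ITS PROVISOS — layer A's rate objects
`lit` (node U3's object tower and letter block, N16's and N15's single-scale layers per run length) and N14's dressed tower of the observable-attached run `ne1`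
(Summits-typed).  Parameters of this file; pinned later BY NAME; no law assumed. -/
structure RateReading₁₂ (N : ℕ) [NeZero N] where
  /-- layer A's rate objects per `(F, θ, hP, g₀, os)` -/
  lit : (F : T4Family) → (θ : Stage12Params F N) → θ.Provisos₁₂ F N → (ℕ → ℝ) → List (ULoop F) → RateObjects₁₁ N
  /-- N14's dressed-tower carriers per `(F, θ, hP, g₀, os)` -/
  ne1 : (F : T4Family) → (θ : Stage12Params F N) → θ.Provisos₁₂ F N → (ℕ → ℝ) → List (ULoop F) → NE1pCarriers

namespace RateReading₁₂

/-- **EMBEDDING OF A PROVISO-FREE ASSIGNMENT** (RR-2's `RateAssignment₁₂`) with a proviso-free dressed-tower assignment: forget the provisos. -/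
def ofAssignment (a : RateAssignment₁₂ N) (ne1 : (F : T4Family) → Stage12Params F N → (ℕ → ℝ) → List (ULoop F) → NE1pCarriers) : RateReading₁₂ N :=
  ⟨fun F θ _ g₀ os => a F θ g₀ os, fun F θ _ g₀ os => ne1 F θ g₀ os⟩

/-- Its rate objects are the assignment's (`rfl`). -/
theorem ofAssignment_lit (a : RateAssignment₁₂ N) (ne1 : (F : T4Family) → Stage12Params F N → (ℕ → ℝ) → List (ULoop F) → NE1pCarriers)
    (F : T4Family) (θ : Stage12Params F N) (hP : θ.Provisos₁₂ F N) (g₀ : ℕ → ℝ) (os : List (ULoop F)) :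
    (ofAssignment a ne1).lit F θ hP g₀ os = a F θ g₀ os := rfl

/-- Its dressed-tower carriers are the assignment's (`rfl`). -/
theorem ofAssignment_ne1 (a : RateAssignment₁₂ N) (ne1 : (F : T4Family) → Stage12Params F N → (ℕ → ℝ) → List (ULoop F) → NE1pCarriers)
    (F : T4Family) (θ : Stage12Params F N) (hP : θ.Provisos₁₂ F N) (g₀ : ℕ → ℝ) (os : List (ULoop F)) :
    (ofAssignment a ne1).ne1 F θ hP g₀ os = ne1 F θ g₀ os := rfl

end RateReading₁₂

/-- **THE STAGE-12 RATE-CARRIER BUNDLE OF RECORD AT RUN LENGTH `k`** read from `𝔯` at `(F, θ, hP, g₀, os)`. -/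
def rateCarriersOfRecord₁₂ (𝔯 : RateReading₁₂ N) (F : T4Family) (θ : Stage12Params F N) (hP : θ.Provisos₁₂ F N) (g₀ : ℕ → ℝ)
    (os : List (ULoop F)) (k : ℕ) : RateCarriers N :=
  ⟨𝔯.ne1 F θ hP g₀ os, ne2OfRecord₁₁ ((𝔯.lit F θ hP g₀ os).ne2 k), ne3OfRecord₁₁ F ((𝔯.lit F θ hP g₀ os).ne3 k),
    u3OfRecord₁₂ θ (𝔯.lit F θ hP g₀ os).u3 k⟩

/-- **THE RATE-CARRIER PREDICATE OF RECORD, STAGE 12, KEYED BY THE DATUM**: at `(F, D, g₀, os)` it pins exactly the bundles of every run length `k` read from `𝔯` at the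
CANONICAL Stage-12 parameter `h.params` of the datum of record `D` with its provisos `h.provisos` (`h : Node00.IsDatumOfRecord₁₂C F N D` — a proposition:
proof-irrelevant, one parameter). -/
def RRec₁₂ (𝔯 : RateReading₁₂ N) : RateRecordPred N :=
  fun F D g₀ os R => ∃ (h : IsDatumOfRecord₁₂C F N D) (k : ℕ), R = rateCarriersOfRecord₁₂ 𝔯 F h.params h.provisos g₀ os k

variable (𝔯 : RateReading₁₂ N)

/-- Unfolding (`Iff.rfl`). -/
theorem rRec₁₂_iff {F : T4Family} (D : Datum F N) (g₀ : ℕ → ℝ) (os : List (ULoop F)) (R : RateCarriers N) :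
    RRec₁₂ 𝔯 F D g₀ os R ↔ ∃ (h : IsDatumOfRecord₁₂C F N D) (k : ℕ), R = rateCarriersOfRecord₁₂ 𝔯 F h.params h.provisos g₀ os k :=
  Iff.rfl

/-- **EVERY LEVEL OF THE READING AT A DATUM KEY IS PINNED AT THAT DATUM.** -/
theorem rRec₁₂_self {F : T4Family} {D : Datum F N} (h : IsDatumOfRecord₁₂C F N D) (g₀ : ℕ → ℝ) (os : List (ULoop F)) (k : ℕ) :
    RRec₁₂ 𝔯 F D g₀ os (rateCarriersOfRecord₁₂ 𝔯 F h.params h.provisos g₀ os k) :=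
  ⟨h, k, rfl⟩

namespace RRec₁₂

variable {𝔯} {F : T4Family} {D : Datum F N} {g₀ : ℕ → ℝ} {os : List (ULoop F)} {R : RateCarriers N}

/-- The datum key and the run length behind a pinned bundle. -/
theorem datumKey (hR : RRec₁₂ 𝔯 F D g₀ os R) :
    ∃ (h : IsDatumOfRecord₁₂C F N D) (k : ℕ), R = rateCarriersOfRecord₁₂ 𝔯 F h.params h.provisos g₀ os k := hR

/-- **TYPED OVER STAGE 12**: a pinned bundle comes with an admissible Stage-12 tuple with provisos realising the datum whose window bounds the bundle's radius
(`R.u3.γ ≤ θ.γ`, here `=`). -/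
theorem stage12 (hR : RRec₁₂ 𝔯 F D g₀ os R) :
    ∃ (θ : Stage12Params F N) (hP : θ.Provisos₁₂ F N), θ.Admissible F N ∧ D = datumOfRecord₁₂ F N θ hP ∧ R.u3.γ ≤ θ.γ := by
  obtain ⟨h, k, rfl⟩ := hR
  exact ⟨h.params, h.provisos, h.admissible, h.eq_datumOfRecord₁₂, le_rfl⟩

/-- **THE HOME-KEYING FACE**: a pinned bundle's datum is a Stage-12 record at a world whose window IS the bundle's radius (`Node00.IsDatumOfRecord₁₂C.exists_world_gamma`). -/
theorem home (hR : RRec₁₂ 𝔯 F D g₀ os R) : ∃ w : DagBinding.WorldP, IsRecordOfRecord₁₂C F N D w ∧ R.u3.γ = w.γ := by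
  obtain ⟨h, k, rfl⟩ := hR
  obtain ⟨w, hw, hγ⟩ := h.exists_world_gamma
  exact ⟨w, hw, hγ.symm⟩

/-- The bundle's window IS `Window R.u3.γ` (the first conjunct of the N22 ∕ N18 slots). -/
theorem window (hR : RRec₁₂ 𝔯 F D g₀ os R) : R.u3.W = Window R.u3.γ := by
  obtain ⟨h, k, rfl⟩ := hR
  rfl

/-- The bundle's moduli ARE `C₉·ω^{k−i}` (the analytic-slot letter clause). -/
theorem moduli (hR : RRec₁₂ 𝔯 F D g₀ os R) : R.u3.Λ = fun a i => R.u3.C₉ * R.u3.ω ^ (a - i) := by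
  obtain ⟨h, k, rfl⟩ := hR
  rfl

/-- The bundle's radius is positive (`0 < θ.γ` from admissibility). -/
theorem gamma_pos (hR : RRec₁₂ 𝔯 F D g₀ os R) : 0 < R.u3.γ := by
  obtain ⟨h, k, rfl⟩ := hR
  exact h.gamma_pos

/-- N16 ∕ N21's block-factor clause: `R.ne3.L = F.L`. -/
theorem ne3_L (hR : RRec₁₂ 𝔯 F D g₀ os R) : R.ne3.L = F.L := by
  obtain ⟨h, k, rfl⟩ := hR
  rfl

/-- … hence `2 ≤ R.ne3.L` (`Node00.two_le_ne3LOfRecord₁₁`). -/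
theorem two_le_ne3_L (hR : RRec₁₂ 𝔯 F D g₀ os R) : 2 ≤ R.ne3.L := by
  obtain ⟨h, k, rfl⟩ := hR
  exact Node00.two_le_ne3LOfRecord₁₁ F

/-- **THE TOWER KEY — EVERY OTHER RUN LENGTH OF THE SAME READING IS AGAIN A BUNDLE OF RECORD AT THE SAME DATUM** (in particular every lower level). -/
theorem other_level (hR : RRec₁₂ 𝔯 F D g₀ os R) (k' : ℕ) :
    ∃ (h : IsDatumOfRecord₁₂C F N D), RRec₁₂ 𝔯 F D g₀ os (rateCarriersOfRecord₁₂ 𝔯 F h.params h.provisos g₀ os k') := by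
  obtain ⟨h, k, rfl⟩ := hR
  exact ⟨h, h, k', rfl⟩

end RRec₁₂

/-- **THE RE-KEY TOOL**: two readings that AGREE on the admissible tuples with provisos key the same predicate (so a definer's pin is ONE pointwise equation). -/
theorem rRec₁₂_congr {𝔯 𝔯' : RateReading₁₂ N}
    (hlit : ∀ (F : T4Family) (θ : Stage12Params F N) (hP : θ.Provisos₁₂ F N), θ.Admissible F N → ∀ (g₀ : ℕ → ℝ) (os : List (ULoop F)),
      𝔯.lit F θ hP g₀ os = 𝔯'.lit F θ hP g₀ os)
    (hne1 : ∀ (F : T4Family) (θ : Stage12Params F N) (hP : θ.Provisos₁₂ F N), θ.Admissible F N → ∀ (g₀ : ℕ → ℝ) (os : List (ULoop F)),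
      𝔯.ne1 F θ hP g₀ os = 𝔯'.ne1 F θ hP g₀ os)
    {F : T4Family} (D : Datum F N) (g₀ : ℕ → ℝ) (os : List (ULoop F)) (R : RateCarriers N) :
    RRec₁₂ 𝔯 F D g₀ os R ↔ RRec₁₂ 𝔯' F D g₀ os R := by
  have key : ∀ (h : IsDatumOfRecord₁₂C F N D) (k : ℕ),
      rateCarriersOfRecord₁₂ 𝔯 F h.params h.provisos g₀ os k = rateCarriersOfRecord₁₂ 𝔯' F h.params h.provisos g₀ os k := fun h k => by
    unfold rateCarriersOfRecord₁₂
    rw [hlit F h.params h.provisos h.admissible g₀ os, hne1 F h.params h.provisos h.admissible g₀ os]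
  constructor
  · rintro ⟨h, k, rfl⟩
    exact ⟨h, k, key h k⟩
  · rintro ⟨h, k, rfl⟩
    exact ⟨h, k, (key h k).symm⟩

/-- **AT A STAGE-12 RECORD PAIR** `(D, w)`: the datum is of record and every run length of the reading at its canonical parameter is pinned at `D`, for every `(g₀, os)`. -/
theorem exists_rRec₁₂_of_isRecordOfRecord₁₂C {F : T4Family} {D : Datum F N} {w : DagBinding.WorldP} (hR : IsRecordOfRecord₁₂C F N D w) :
    ∃ h : IsDatumOfRecord₁₂C F N D, ∀ (g₀ : ℕ → ℝ) (os : List (ULoop F)) (k : ℕ),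
      RRec₁₂ 𝔯 F D g₀ os (rateCarriersOfRecord₁₂ 𝔯 F h.params h.provisos g₀ os k) :=
  ⟨Node00.isDatumOfRecord₁₂C_of_isRecordOfRecord₁₂C hR, fun g₀ os k => rRec₁₂_self 𝔯 _ g₀ os k⟩

/-! ## §3 The one-application instances of the K4 stubs at `RRec₁₂ 𝔯` -/

/-- **THE θ-FORM TRANSFER**: a property of the reading's bundles established at EVERY admissible Stage-12 parameter with provisos holds at the canonical parameter of
every Stage-12 datum of record (how a consumer's ∀θ-theorem feeds the `iff`s below; `Node00.IsDatumOfRecord₁₂C.forall_params`'s pattern). -/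
theorem forall_datumKey₁₂_of_forall_admissible
    {P : (F : T4Family) → Datum F N → (θ : Stage12Params F N) → θ.Provisos₁₂ F N → (ℕ → ℝ) → List (ULoop F) → ℕ → Prop}
    (hP : ∀ (F : T4Family) (θ : Stage12Params F N) (hθ : θ.Provisos₁₂ F N), θ.Admissible F N →
      ∀ (g₀ : ℕ → ℝ) (os : List (ULoop F)) (k : ℕ), P F (datumOfRecord₁₂ F N θ hθ) θ hθ g₀ os k)
    (F : T4Family) (D : Datum F N) (h : IsDatumOfRecord₁₂C F N D) (g₀ : ℕ → ℝ) (os : List (ULoop F)) (k : ℕ) :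
    P F D h.params h.provisos g₀ os k := by
  have := hP F h.params h.provisos h.admissible g₀ os k
  rwa [← h.eq_datumOfRecord₁₂] at this

/-- **N14 at the Stage-12 home**: `S_N14 (RRec₁₂ 𝔯)` IS NE1′ at the dressed tower `𝔯.ne1` read at every datum key (CONTENTFUL ONLY FOR A NAMED `𝔯.ne1`). -/
theorem s_N14_rRec₁₂_iff : S_N14 (RRec₁₂ 𝔯) ↔ ∀ (F : T4Family) (D : Datum F N) (h : IsDatumOfRecord₁₂C F N D) (g₀ : ℕ → ℝ) (os : List (ULoop F)),
    N14At (𝔯.ne1 F h.params h.provisos g₀ os) := by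
  constructor
  · intro hS F D h g₀ os
    exact hS F D g₀ os _ ⟨h, 0, rfl⟩
  · rintro hS F D g₀ os R ⟨h, k, rfl⟩
    exact hS F D h g₀ os

/-- **N15 at the Stage-12 home**: the three NE2⁺ layers at the level-`k` paired instances of the reading. -/
theorem s_N15_rRec₁₂_iff : S_N15 (RRec₁₂ 𝔯) ↔ ∀ (F : T4Family) (D : Datum F N) (h : IsDatumOfRecord₁₂C F N D) (g₀ : ℕ → ℝ) (os : List (ULoop F))
    (k : ℕ), N15At (ne2OfRecord₁₁ ((𝔯.lit F h.params h.provisos g₀ os).ne2 k)) := by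
  constructor
  · intro hS F D h g₀ os k
    exact hS F D g₀ os _ ⟨h, k, rfl⟩
  · rintro hS F D g₀ os R ⟨h, k, rfl⟩
    exact hS F D h g₀ os k

/-- **N16 at the Stage-12 home**: NE3 at the level-`k` NE3 objects of the reading with the family's block factor. -/
theorem s_N16_rRec₁₂_iff : S_N16 (RRec₁₂ 𝔯) ↔ ∀ (F : T4Family) (D : Datum F N) (h : IsDatumOfRecord₁₂C F N D) (g₀ : ℕ → ℝ) (os : List (ULoop F))
    (k : ℕ), N16At (ne3OfRecord₁₁ F ((𝔯.lit F h.params h.provisos g₀ os).ne3 k)) := by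
  constructor
  · intro hS F D h g₀ os k
    exact hS F D g₀ os _ ⟨h, k, rfl⟩
  · rintro hS F D g₀ os R ⟨h, k, rfl⟩
    exact hS F D h g₀ os k

/-- **N17 at the Stage-12 home**: NE4 ON THE DATUM at the dependent letters `(cr·C₅·θ₅, ρ, θ.γ)` of the reading's letter block (level-free: K-uniform letters). -/
theorem s_N17_rRec₁₂_iff : S_N17 (RRec₁₂ 𝔯) ↔ ∀ (F : T4Family) (D : Datum F N) (h : IsDatumOfRecord₁₂C F N D) (g₀ : ℕ → ℝ) (os : List (ULoop F))
    (k : ℕ), N17At D (u3OfRecord₁₂ h.params (𝔯.lit F h.params h.provisos g₀ os).u3 k) := by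
  constructor
  · intro hS F D h g₀ os k
    exact hS F D g₀ os _ ⟨h, k, rfl⟩
  · rintro hS F D g₀ os R ⟨h, k, rfl⟩
    exact hS F D h g₀ os k

/-- **N18 at the Stage-12 home**: NE5 at EVERY level `k` of the reading's object tower, on `]0, θ.γ]`, at the letter block's `(κ, θ₅, C₅)`. -/
theorem s_N18_rRec₁₂_iff : S_N18 (RRec₁₂ 𝔯) ↔ ∀ (F : T4Family) (D : Datum F N) (h : IsDatumOfRecord₁₂C F N D) (g₀ : ℕ → ℝ) (os : List (ULoop F))
    (k : ℕ), N18At (u3OfRecord₁₂ h.params (𝔯.lit F h.params h.provisos g₀ os).u3 k) := by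
  constructor
  · intro hS F D h g₀ os k
    exact hS F D g₀ os _ ⟨h, k, rfl⟩
  · rintro hS F D g₀ os R ⟨h, k, rfl⟩
    exact hS F D h g₀ os k

/-- **N22 at the Stage-12 home**: NE9 ∧ fading memory at EVERY level `k` of the reading's object tower — by `n22At_u3OfRecord₁₂_iff`, under the letter signs this is NE9 ALONE. -/
theorem s_N22_rRec₁₂_iff : S_N22 (RRec₁₂ 𝔯) ↔ ∀ (F : T4Family) (D : Datum F N) (h : IsDatumOfRecord₁₂C F N D) (g₀ : ℕ → ℝ) (os : List (ULoop F))
    (k : ℕ), N22At (u3OfRecord₁₂ h.params (𝔯.lit F h.params h.provisos g₀ os).u3 k) := by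
  constructor
  · intro hS F D h g₀ os k
    exact hS F D g₀ os _ ⟨h, k, rfl⟩
  · rintro hS F D g₀ os R ⟨h, k, rfl⟩
    exact hS F D h g₀ os k

/-- **(D4) at the Stage-12 home**: the β-read-out binders on the datum at every level bundle. -/
theorem s_D4_rRec₁₂_iff : S_D4 (RRec₁₂ 𝔯) ↔ ∀ (F : T4Family) (D : Datum F N) (h : IsDatumOfRecord₁₂C F N D) (g₀ : ℕ → ℝ) (os : List (ULoop F))
    (k : ℕ), ReadOutAt D (u3OfRecord₁₂ h.params (𝔯.lit F h.params h.provisos g₀ os).u3 k) := by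
  constructor
  · intro hS F D h g₀ os k
    exact hS F D g₀ os _ ⟨h, k, rfl⟩
  · rintro hS F D g₀ os R ⟨h, k, rfl⟩
    exact hS F D h g₀ os k

/-- **K4's ∃-HOOK AT THE STAGE-12 HOME**: `RateInputs (RRec₁₂ 𝔯) F D g₀ os` IS «`D` is a Stage-12 datum of record and SOME run length of the reading carries the six
in-edges of N19». -/
theorem rateInputs_rRec₁₂_iff {F : T4Family} (D : Datum F N) (g₀ : ℕ → ℝ) (os : List (ULoop F)) :
    RateInputs (RRec₁₂ 𝔯) F D g₀ os ↔
      ∃ (h : IsDatumOfRecord₁₂C F N D) (k : ℕ), RatesAt D (rateCarriersOfRecord₁₂ 𝔯 F h.params h.provisos g₀ os k) := by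
  constructor
  · rintro ⟨R, ⟨h, k, rfl⟩, hr⟩
    exact ⟨h, k, hr⟩
  · rintro ⟨h, k, hr⟩
    exact ⟨_, ⟨h, k, rfl⟩, hr⟩

/-- **K4's ∀-HOOK AT THE STAGE-12 HOME** (the hook K5's N19 reads at a per-level home, `…N22AtRateRecord11.rateInputsAll_rRec₁₁_iff`'s twin): `RateInputsAll (RRec₁₂ 𝔯) F D g₀ os`
IS «at every Stage-12 datum key of `D`, EVERY run length of the reading carries the six in-edges of N19». -/
theorem rateInputsAll_rRec₁₂_iff {F : T4Family} (D : Datum F N) (g₀ : ℕ → ℝ) (os : List (ULoop F)) :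
    RateInputsAll (RRec₁₂ 𝔯) F D g₀ os ↔
      ∀ (h : IsDatumOfRecord₁₂C F N D) (k : ℕ), RatesAt D (rateCarriersOfRecord₁₂ 𝔯 F h.params h.provisos g₀ os k) := by
  constructor
  · intro hall h k
    exact hall _ ⟨h, k, rfl⟩
  · rintro hall R ⟨h, k, rfl⟩
    exact hall h k

/-! ## §4 K4's existence stub PROVED at the Stage-12 home; the K0′ link; honesty at both stages -/

/-- **`S_R00x` AT THE STAGE-12 HOME, PROVED OUTRIGHT**: at every Stage-12 record the rate carriers of record EXIST under the pins for every tuned run and loop string —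
witness the run-length-`0` bundle at the record's own datum key (thresholds trivial, `ForSmallCouplings.of_forall`).  Existence is FREE because the objects are residual
(located, not content). -/
theorem s_R00x_rRec₁₂ : S_R00x (fun F D w => IsRecordOfRecord₁₂C F N D w) (RRec₁₂ 𝔯) := by
  intro F D w hR _ _
  obtain ⟨h, hall⟩ := exists_rRec₁₂_of_isRecordOfRecord₁₂C 𝔯 hR
  exact T4ContinuumYM4Torus.ForSmallCouplings.of_forall fun g₀ os => ⟨_, hall g₀ os 0⟩

/-- **K0′ LINK, positive side**: under the body of rev 8's K0′ `Record12Inhabited` at `N` the predicate pins, on every family and for every `(g₀, os, k)`, a bundle at a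
Stage-12 datum of record. -/
theorem exists_pinned_rRec₁₂_of_inhabited
    (hK0 : ∀ F : T4Family, ∃ (D : Datum F N) (w : DagBinding.WorldP), IsRecordOfRecord₁₂C F N D w)
    (F : T4Family) (g₀ : ℕ → ℝ) (os : List (ULoop F)) (k : ℕ) :
    ∃ (D : Datum F N) (w : DagBinding.WorldP) (R : RateCarriers N), IsRecordOfRecord₁₂C F N D w ∧ RRec₁₂ 𝔯 F D g₀ os R := by
  obtain ⟨D, w, hR⟩ := hK0 F
  obtain ⟨h, hall⟩ := exists_rRec₁₂_of_isRecordOfRecord₁₂C 𝔯 hR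
  exact ⟨D, w, _, hR, hall g₀ os k⟩

/-- **HONESTY — hypothesis form**: if NO Stage-12 datum of record exists at `N` on any family (the negation of K0′'s body), the seven K4 stubs hold at `RRec₁₂ 𝔯` WITH NO
ESTIMATE; the Stage-12 knit of the NE-side is worth exactly K0′ (`S_R00x` is the existence side and is proved above regardless). -/
theorem k4_rRec₁₂_of_uninhabited (hno : ∀ (F : T4Family) (D : Datum F N), ¬ IsDatumOfRecord₁₂C F N D) :
    S_N14 (RRec₁₂ 𝔯) ∧ S_N15 (RRec₁₂ 𝔯) ∧ S_N16 (RRec₁₂ 𝔯) ∧ S_N17 (RRec₁₂ 𝔯) ∧ S_N18 (RRec₁₂ 𝔯) ∧ S_N22 (RRec₁₂ 𝔯) ∧ S_D4 (RRec₁₂ 𝔯) := by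
  refine ⟨?_, ?_, ?_, ?_, ?_, ?_, ?_⟩ <;>
  · rintro F D g₀ os R ⟨h, k, -⟩
    exact absurd h (hno F D)

/-- **THE LOCATED VACUITY OF THE STAGE-11 HOME — kernel fact** (node00-def-T LOCATED-2, `Node00.not_isRecordOfRecord₁₁C`): NO Stage-11 datum of record exists (any
family, any `N`), so for EVERY Stage-11 reading `𝔯` the seven K4 stubs at layer B's `RRec₁₁ 𝔯` (p457330) hold WITH NO ESTIMATE.  Every Stage-11 home module of the NE-side
(N14 ∕ N16 ∕ N17 ∕ N18 ∕ N19 ∕ N21 ∕ N22 at `RRec₁₁`) is thereby contentless as a hypothesis-taker; the content starts at `RRec₁₂`.  R457 (A) vacuity certificate;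
COUNT-NEUTRAL; nothing of Bałaban's refuted (the defect is the typed all-runs proviso, not print). -/
theorem k4_rRec₁₁_outright (𝔯 : RateReading₁₁ N) :
    S_N14 (RRec₁₁ 𝔯) ∧ S_N15 (RRec₁₁ 𝔯) ∧ S_N16 (RRec₁₁ 𝔯) ∧ S_N17 (RRec₁₁ 𝔯) ∧ S_N18 (RRec₁₁ 𝔯) ∧ S_N22 (RRec₁₁ 𝔯) ∧ S_D4 (RRec₁₁ 𝔯) :=
  k4_rRec₁₁_of_uninhabited 𝔯 fun F D h => by
    obtain ⟨w, hw⟩ := Node00.isDatumOfRecord₁₁C_iff_exists_world.mp h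
    exact Node00.not_isRecordOfRecord₁₁C F N D w hw

/-- … and K4's ∀-hook at the Stage-11 home holds at EVERY `(F, D, g₀, os)` with no estimate (no bundle is pinned). -/
theorem rateInputsAll_rRec₁₁_outright (𝔯 : RateReading₁₁ N) (F : T4Family) (D : Datum F N) (g₀ : ℕ → ℝ) (os : List (ULoop F)) :
    RateInputsAll (RRec₁₁ 𝔯) F D g₀ os := by
  rintro R ⟨h, k, -⟩
  obtain ⟨w, hw⟩ := Node00.isDatumOfRecord₁₁C_iff_exists_world.mp h
  exact absurd hw (Node00.not_isRecordOfRecord₁₁C F N D w)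

/-- … while K4's ∃-hook at the Stage-11 home is FALSE at every `(F, D, g₀, os)` (no Stage-11 datum of record exists) — the two hooks part ways exactly at the empty key. -/
theorem not_rateInputs_rRec₁₁ (𝔯 : RateReading₁₁ N) (F : T4Family) (D : Datum F N) (g₀ : ℕ → ℝ) (os : List (ULoop F)) :
    ¬ RateInputs (RRec₁₁ 𝔯) F D g₀ os := by
  rintro ⟨R, ⟨h, k, -⟩, -⟩
  obtain ⟨w, hw⟩ := Node00.isDatumOfRecord₁₁C_iff_exists_world.mp h
  exact Node00.not_isRecordOfRecord₁₁C F N D w hw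

end YMDAG.UVSplit

end
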